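import Summits.Ventures.GridStability.Models.DroopQVDeflateRows

/-!
# GridStability/Models/DroopQVDeflateSeq — SEQUENTIAL-ACCESS evaluator for the deflation-lane rows `S(−J) + (S(−J))ᵀ − 2r₀S − δ·1` (`O(n³)` kernel steps instead of `O(n⁴)`)

Cell `gridfusion` (LADDER-GRIDFUSION, APEX LINE rung G3.b; seat gridfusion-model-8 (g2); LEVER «L-seq» of the RATE-lane kernel census posted
2026-08-27T15:05Z). Finding on the `n = 10` census object (NE39 droop+QV, 30 states): the in-kernel evaluation of `H − δ·1` costs ≈ 20 s in BOTH the
exact lane (`Models/NE39DroopQVDeflate.lean`, 106-digit heights) and the model-twin lane (10-digit heights) — big-number arithmetic is NOT the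
bottleneck; `DeflRows.lyapRows` (p536118) reads `S_ik`, `J_kj` with `List.getD` (`O(n)` per access) inside the `k`-sum, i.e. `O(n⁴)` list steps
(≈ 8·10⁵ per product at `n = 10`, ≈ 2·10⁸ at `n = 40`). This file supplies the `O(n³)` evaluator and its ONCE-PROVED semantics:
* `axpy c row acc` (length-preserving `acc + c·row`), `rowAcc`, `rowTimes n s J = Σ_{k<n} s_k·J_k` (row vector × row list in lock-step),
  spec `getD_rowTimes`: entry `j` = `Σ_{k : Fin n} s_k (J_k)_j` through `List.getD` (the `matrixOfRows` reading);
* `comb3`, `rowN`, and **`lyapRowsSeq n κ δ S J JT`** (generic over a commutative ring: `κ = 2r₀` over `ℚ`; over `ℤ` it evaluates `2^K·(H(J̃) − δ·1)` of an integer-scaled rounded model, lever «L-int»): row `i` = `mapIdx`-shifted `comb3` of ONE pass `rowTimes n S_i J` (row `i` of `S J`), ONE pass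
  `rowTimes n JT_i S` (row `i` of `Jᵀ S = (S J)ᵀ` for symmetric `S`; `JT` = a literal transpose supplied by the emitter and checked entrywise) and `S_i`;
* **`matrixOfRows_lyapRowsSeq`**: under `JT = Jᵀ` and `S = Sᵀ` on the window, `matrixOfRows n n (lyapRowsSeq n κ δ S J JT)
  = M_S(−M_J) + (M_S(−M_J))ᵀ − κ·M_S − δ·1` — the `hH` hypothesis of `DeflRows.quadForm_nonneg_of_modelTwin_rows` / the bridge of the exact lane.
THREE COLUMNS. CERTIFIED (kernel): list/matrix algebra only; no instance, no parameter, no certificate. No sentence of this file says a grid,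
a microgrid or a converter is stable.
-/

namespace Summit.Ventures.GridStability.Models

open Matrix Literature.Computation.Certificates

namespace DeflRows

section Generic

variable {α : Type*} [CommRing α]

/-- Length-preserving `acc + c·row` on lists (missing row entries read as `0`). [folklore] -/
def axpy (c : α) : List α → List α → List α
  | r :: rs, a :: as => (a + c * r) :: axpy c rs as
  | [], as => as
  | _ :: _, [] => []

/-- Accumulate `acc + Σ_k cs_k · rs_k` over two lists walked in lock-step (row vector times row list). [folklore] -/
def rowAcc : List α → List (List α) → List α → List α
  | c :: cs, r :: rs, acc => rowAcc cs rs (axpy c r acc)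
  | [], _, acc => acc
  | _ :: _, [], acc => acc

/-- Row `i` of `M_S · M_J` on the `n`-window, sequential access: `Σ_{k<n} s_k · J_k` starting from the zero row of length `n`. [folklore] -/
def rowTimes (n : ℕ) (s : List α) (J : List (List α)) : List α := rowAcc (s.take n) (J.take n) (List.replicate n 0)

/-- Spec function: `Σ_k cs_k · (rs_k)_j` over the lock-step walk. [folklore] -/
def dotCol (j : ℕ) : List α → List (List α) → α
  | c :: cs, r :: rs => c * r.getD j 0 + dotCol j cs rs
  | [], _ => 0
  | _ :: _, [] => 0

/-- `axpy` preserves the accumulator's length. [folklore] -/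
theorem length_axpy (c : α) : ∀ (row acc : List α), (axpy c row acc).length = acc.length
  | r :: rs, a :: as => by simp [axpy, length_axpy c rs as]
  | [], as => by simp [axpy]
  | _ :: _, [] => by simp [axpy]

/-- Entry `j` of `axpy c row acc` is `acc_j + c·row_j` (missing row entries read `0`). [folklore] -/
theorem getD_axpy (c : α) : ∀ (row acc : List α) (j : ℕ), j < acc.length →
    (axpy c row acc).getD j 0 = acc.getD j 0 + c * row.getD j 0
  | r :: rs, a :: as, 0, _ => by simp [axpy]
  | r :: rs, a :: as, j + 1, h => by
      simp only [axpy, List.getD_cons_succ]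
      exact getD_axpy c rs as j (by simpa using h)
  | [], as, j, _ => by simp [axpy]
  | _ :: _, [], j, h => by simp at h

/-- `rowAcc` preserves the accumulator's length. [folklore] -/
theorem length_rowAcc : ∀ (cs : List α) (rs : List (List α)) (acc : List α), (rowAcc cs rs acc).length = acc.length
  | c :: cs, r :: rs, acc => by rw [rowAcc, length_rowAcc cs rs, length_axpy]
  | [], _, acc => by simp [rowAcc]
  | _ :: _, [], acc => by simp [rowAcc]

/-- Entry `j` of `rowAcc cs rs acc` is `acc_j + dotCol j cs rs`. [folklore] -/
theorem getD_rowAcc : ∀ (cs : List α) (rs : List (List α)) (acc : List α) (j : ℕ), j < acc.length →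
    (rowAcc cs rs acc).getD j 0 = acc.getD j 0 + dotCol j cs rs
  | c :: cs, r :: rs, acc, j, h => by
      rw [rowAcc, getD_rowAcc cs rs _ j (by rw [length_axpy]; exact h), getD_axpy c r acc j h, dotCol]
      ring
  | [], rs, acc, j, _ => by cases rs <;> simp [rowAcc, dotCol]
  | _ :: _, [], acc, j, _ => by simp [rowAcc, dotCol]

/-- `dotCol` over the `n`-truncated lists is the `Fin n` sum read through `List.getD`. [folklore] -/
theorem dotCol_take : ∀ (n : ℕ) (j : ℕ) (s : List α) (J : List (List α)),
    dotCol j (s.take n) (J.take n) = ∑ k : Fin n, s.getD k.val 0 * (J.getD k.val []).getD j 0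
  | 0, j, s, J => by simp [dotCol]
  | n + 1, j, [], J => by
      simp [dotCol]
  | n + 1, j, c :: cs, [] => by
      simp [dotCol]
  | n + 1, j, c :: cs, r :: rs => by
      rw [List.take_succ_cons, List.take_succ_cons, dotCol, dotCol_take n j cs rs, Fin.sum_univ_succ]
      simp

/-- **Semantics of `rowTimes`**: entry `j < n` of row `i`'s product is `Σ_{k : Fin n} S_ik J_kj` (all reads through `List.getD`). [folklore] -/
theorem getD_rowTimes (n : ℕ) (s : List α) (J : List (List α)) (j : Fin n) :
    (rowTimes n s J).getD j.val 0 = ∑ k : Fin n, s.getD k.val 0 * (J.getD k.val []).getD j.val 0 := by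
  rw [rowTimes, getD_rowAcc _ _ _ _ (by simp), dotCol_take]
  simp

/-- Combine three rows entrywise: `−a − b − 2r₀·c` (length of the shortest). [folklore] -/
def comb3 (κ : α) : List α → List α → List α → List α
  | a :: as, b :: bs, c :: cs => (-a - b - κ * c) :: comb3 κ as bs cs
  | _, _, _ => []

/-- Entry `j` of `comb3 κ as bs cs` inside the common length. [folklore] -/
theorem getD_comb3 (κ : α) : ∀ (as bs cs : List α) (j : ℕ), j < as.length → j < bs.length → j < cs.length →
    (comb3 κ as bs cs).getD j 0 = -(as.getD j 0) - bs.getD j 0 - κ * cs.getD j 0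
  | a :: as, b :: bs, c :: cs, 0, _, _, _ => by simp [comb3]
  | a :: as, b :: bs, c :: cs, j + 1, ha, hb, hc => by
      simp only [comb3, List.getD_cons_succ]
      exact getD_comb3 κ as bs cs j (by simpa using ha) (by simpa using hb) (by simpa using hc)
  | [], _, _, j, h, _, _ => by simp at h
  | _ :: _, [], _, j, _, h, _ => by simp at h
  | _ :: _, _ :: _, [], j, _, _, h => by simp at h

/-- Length of `comb3` = the shortest input length. [folklore] -/
theorem length_comb3 (κ : α) : ∀ (as bs cs : List α), (comb3 κ as bs cs).length = min as.length (min bs.length cs.length)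
  | a :: as, b :: bs, c :: cs => by simp only [comb3, List.length_cons, length_comb3 κ as bs cs]; omega
  | [], bs, cs => by cases bs <;> cases cs <;> simp [comb3]
  | a :: as, [], cs => by cases cs <;> simp [comb3]
  | a :: as, b :: bs, [] => by simp [comb3]

/-- Reading a diagonal-shifted row. [folklore] -/
theorem getD_mapIdx_shift (l : List α) (i j : ℕ) (δ : α) (hj : j < l.length) :
    (l.mapIdx fun k x => if k = i then x - δ else x).getD j 0 = if j = i then l.getD j 0 - δ else l.getD j 0 := by
  rw [List.getD_eq_getElem?_getD, List.getElem?_mapIdx, List.getElem?_eq_getElem hj, List.getD_eq_getElem?_getD,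
    List.getElem?_eq_getElem hj]
  simp

/-- Pad/trim a row to length `n` through `List.getD` (so every row of the window has length exactly `n`). [folklore] -/
def rowN (n : ℕ) (row : List α) : List α := (List.finRange n).map fun j : Fin n => row.getD j.val 0

/-- **Sequential-access rows** of `M_S(−M_J) + (M_S(−M_J))ᵀ − (2r₀)·M_S − δ·1` on the `n`-window: row `i` is built from ONE pass
`Σ_k S_ik J_k` (row `i` of `S·J`), ONE pass `Σ_k (Jᵀ)_ik S_k` (row `i` of `Jᵀ S = (S J)ᵀ` when `S` is symmetric — `JT` is a literal
transpose supplied by the emitter) and an entrywise combination; `O(n²)` kernel steps per row, `O(n³)` in total. [folklore] -/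
def lyapRowsSeq (n : ℕ) (κ δ : α) (S J JT : List (List α)) : List (List α) :=
  (List.finRange n).map fun i : Fin n =>
    (comb3 κ (rowTimes n (S.getD i.val []) J) (rowTimes n (JT.getD i.val []) S) (rowN n (S.getD i.val []))).mapIdx
      fun j x => if j = i.val then x - δ else x

/-- **Matrix semantics of `lyapRowsSeq`** (given that `JT` is the transpose of `J` and `S` is symmetric on the window):
`matrixOfRows n n (lyapRowsSeq n r₀ δ S J JT) = M_S·(−M_J) + (M_S·(−M_J))ᵀ − (2r₀)·M_S − δ·1`. [folklore] -/
theorem matrixOfRows_lyapRowsSeq (n : ℕ) (κ δ : α) (S J JT : List (List α))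
    (hJT : ∀ i j : Fin n, matrixOfRows n n JT i j = matrixOfRows n n J j i)
    (hS : ∀ i j : Fin n, matrixOfRows n n S i j = matrixOfRows n n S j i) :
    matrixOfRows n n (lyapRowsSeq n κ δ S J JT)
      = matrixOfRows n n S * (-matrixOfRows n n J) + (matrixOfRows n n S * (-matrixOfRows n n J))ᵀ
          - κ • matrixOfRows n n S - δ • (1 : Matrix (Fin n) (Fin n) α) := by
  ext i j
  rw [matrixOfRows_apply, lyapRowsSeq, getD_map_finRange]
  have hlen1 : (rowTimes n (S.getD i.val []) J).length = n := by rw [rowTimes, length_rowAcc]; simp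
  have hlen2 : (rowTimes n (JT.getD i.val []) S).length = n := by rw [rowTimes, length_rowAcc]; simp
  have hlen3 : (rowN n (S.getD i.val [])).length = n := by simp [rowN]
  have hlenC : (comb3 κ (rowTimes n (S.getD i.val []) J) (rowTimes n (JT.getD i.val []) S) (rowN n (S.getD i.val []))).length = n := by
    rw [length_comb3, hlen1, hlen2, hlen3]; simp
  rw [getD_mapIdx_shift _ _ _ _ (by rw [hlenC]; exact j.isLt)]
  rw [getD_comb3 κ _ _ _ _ (by rw [hlen1]; exact j.isLt) (by rw [hlen2]; exact j.isLt) (by rw [hlen3]; exact j.isLt),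
    getD_rowTimes, getD_rowTimes]
  have hrowN : (rowN n (S.getD i.val [])).getD j.val 0 = (S.getD i.val []).getD j.val 0 := by
    rw [rowN, getD_map_finRange]
  rw [hrowN]
  simp only [Matrix.add_apply, Matrix.sub_apply, Matrix.smul_apply, Matrix.transpose_apply, Matrix.mul_apply,
    Matrix.neg_apply, Matrix.one_apply, matrixOfRows_apply, smul_eq_mul, mul_neg]
  have hT : ∑ k : Fin n, (JT.getD i.val []).getD k.val 0 * (S.getD k.val []).getD j.val 0
      = ∑ k : Fin n, (S.getD j.val []).getD k.val 0 * (J.getD k.val []).getD i.val 0 := by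
    refine Finset.sum_congr rfl fun k _ => ?_
    have h1 := hJT i k
    have h2 := hS k j
    simp only [matrixOfRows_apply] at h1 h2
    rw [h1, h2, mul_comm]
  rw [hT]
  by_cases hij : i = j
  · subst hij; simp; ring
  · have : ¬ (j.val = i.val) := fun h => hij (Fin.ext h.symm)
    simp [hij, this]; ring

end Generic

/-! ## The integer lane «L-int»: evaluate `2^K·(H(J̃) − δ·1)` over `ℤ`, divide once per entry -/

/-- Entrywise-mapped row tables read through `matrixOfRows` (for maps fixing `0`). [folklore] -/
theorem matrixOfRows_map_map {α β : Type*} [Zero α] [Zero β] (f : α → β) (hf : f 0 = 0) (m n : ℕ) (rows : List (List α)) :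
    matrixOfRows m n (rows.map fun row => row.map f) = (matrixOfRows m n rows).map f := by
  ext i j
  simp only [matrixOfRows_apply, Matrix.map_apply, List.getD_eq_getElem?_getD, List.getElem?_map]
  cases rows[i.val]? with
  | none => simp [hf]
  | some row =>
      simp only [Option.map_some, Option.getD_some, List.getElem?_map]
      cases row[j.val]? with
      | none => simp [hf]
      | some x => simp

/-- **Bridge of the integer lane.** With integer tables `S` (symmetric on the window), `M` (`= 2^K·J̃`) and `MT` (its transpose on the window),
`κZ = 2r₀·d` and `dZ = δ·d` integers (`d` = the model scale, e.g. `2^K`), the INTEGER rows `lyapRowsSeq n κZ dZ S M MT` divided entrywise by `d` ARE the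
`δ`-shifted `H` rows of the rounded model `J̃ = M/d` against `S` read over `ℚ`: all `2n³` multiply-adds happen in `ℤ`, one `ℚ` division per entry. [folklore] -/
theorem matrixOfRows_intLane (n : ℕ) (d r₀ δ : ℚ) (κZ dZ : ℤ) (S M MT : List (List ℤ))
    (hMT : ∀ i j : Fin n, matrixOfRows n n MT i j = matrixOfRows n n M j i)
    (hS : ∀ i j : Fin n, matrixOfRows n n S i j = matrixOfRows n n S j i)
    (hd : d ≠ 0) (hκ : (κZ : ℚ) = 2 * r₀ * d) (hδ : (dZ : ℚ) = δ * d) :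
    matrixOfRows n n ((lyapRowsSeq n κZ dZ S M MT).map fun row => row.map fun z : ℤ => (z : ℚ) / d)
      = matrixOfRows n n (S.map fun row => row.map fun z : ℤ => (z : ℚ))
          * (-matrixOfRows n n (M.map fun row => row.map fun z : ℤ => (z : ℚ) / d))
        + (matrixOfRows n n (S.map fun row => row.map fun z : ℤ => (z : ℚ))
          * (-matrixOfRows n n (M.map fun row => row.map fun z : ℤ => (z : ℚ) / d)))ᵀ
        - (2 * r₀) • matrixOfRows n n (S.map fun row => row.map fun z : ℤ => (z : ℚ)) - δ • (1 : Matrix (Fin n) (Fin n) ℚ) := by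
  rw [matrixOfRows_map_map (fun z : ℤ => (z : ℚ) / d) (by simp), matrixOfRows_lyapRowsSeq n κZ dZ S M MT hMT hS,
    matrixOfRows_map_map (fun z : ℤ => (z : ℚ)) (by simp), matrixOfRows_map_map (fun z : ℤ => (z : ℚ) / d) (by simp)]
  ext i j
  simp only [Matrix.map_apply, Matrix.add_apply, Matrix.sub_apply, Matrix.smul_apply, Matrix.transpose_apply, Matrix.mul_apply,
    Matrix.neg_apply, Matrix.one_apply, smul_eq_mul]
  push_cast
  simp only [mul_neg, Finset.sum_neg_distrib, mul_div_assoc', ← Finset.sum_div]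
  rw [hκ, hδ]
  split_ifs <;> field_simp

end DeflRows

end Summit.Ventures.GridStability.Models
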